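import Mathlib.FieldTheory.IsAlgClosed.AlgebraicClosure
import Mathlib.Algebra.CubicDiscriminant
import Mathlib.Algebra.QuadraticDiscriminant
import Mathlib.Algebra.Polynomial.Roots
import HarnessLib

/-!
# Counting distinct roots of quadratics and cubics over an algebraically closed field

Auxiliary results for the correctness proof of Tate's algorithm in residue characteristic
`≠ 2, 3` (`Literature.NumberTheory.DiophantineGeometry.TateAlgorithm`, Silverman ATAEC IV.9.4):
steps 6, 7 and 8 of the algorithm test the number of *distinct* roots in `k̄` of an auxiliary
quadratic or cubic polynomial over the residue field `k` (`Literature.NumberTheory.DiophantineGeometry.TateAlgorithm.distinctRootCount`).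
Here we express these counts through discriminants:

* `card_aroots_toFinset_quadratic_eq_two_iff`: for `a ≠ 0` and `2 ≠ 0` in `k`,
  `a X² + b X + c` has two distinct roots in `L ⊇ k` algebraically closed iff `b² − 4ac ≠ 0`;
* `card_aroots_toFinset_cubic_eq_three_iff`: `X³ + p X² + q X + r` has three distinct roots iff
  its discriminant `p²q² − 4q³ − 4p³r − 27r² + 18pqr` is nonzero;
* `card_aroots_toFinset_cubic_eq_two_iff`: if the discriminant vanishes, it has exactly two
  distinct roots iff `p² − 3q ≠ 0`;
* `exists_double_root_of_cubicDiscr_eq_zero`: if the discriminant vanishes, `p² ≠ 3q` and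
  `2 ≠ 0`, the double root `(9r − pq) / (2 (p² − 3q))` lies in `k`.

All of this is elementary (Vieta's formulae via Mathlib's `Cubic.eq_sum_three_roots`,
`quadratic_eq_zero_iff`).

## References

* J. H. Silverman, *Advanced Topics in the Arithmetic of Elliptic Curves*, GTM 151, 1994, IV.9.4
  (steps 6–8: "distinct roots in `k̄`", `Disc(P)`).
-/

open Polynomial

namespace Literature.NumberTheory.DiophantineGeometry

namespace TateAlgorithm

section Quadratic

variable {k : Type*} [Field k] {L : Type*} [Field L] [Algebra k L] [IsAlgClosed L]

omit [IsAlgClosed L] in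
/-- Membership in the roots over `L` of the quadratic `a X² + b X + c` (`a ≠ 0`). [folklore] -/
theorem mem_aroots_quadratic_iff {a b c : k} (ha : a ≠ 0) (x : L) :
    x ∈ (C a * X ^ 2 + C b * X + C c).aroots L ↔
      algebraMap k L a * (x * x) + algebraMap k L b * x + algebraMap k L c = 0 := by
  have hne : (C a * X ^ 2 + C b * X + C c) ≠ 0 := by
    rw [← Cubic.of_a_eq_zero' (b := a) (c := b) (d := c)]
    exact Cubic.ne_zero_of_b_ne_zero ha
  rw [mem_aroots, and_iff_right hne]
  simp only [map_add, map_mul, aeval_C, map_pow, aeval_X]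
  ring_nf

/-- Over an algebraically closed field `L ⊇ k` with `2 ≠ 0`, the quadratic `a X² + b X + c`
(`a ≠ 0`, coefficients in `k`) has exactly two distinct roots iff its discriminant `b² − 4ac` is
nonzero. Silverman ATAEC IV.9.4, steps 7–8 ("distinct roots in `k̄`"). [folklore] -/
theorem card_aroots_toFinset_quadratic_eq_two_iff [DecidableEq L] {a b c : k} (ha : a ≠ 0)
    (h2 : (2 : k) ≠ 0) :
    ((C a * X ^ 2 + C b * X + C c).aroots L).toFinset.card = 2 ↔ b ^ 2 - 4 * a * c ≠ 0 := by
  set a' := algebraMap k L a with ha'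
  set b' := algebraMap k L b with hb'
  set c' := algebraMap k L c with hc'
  have hinj := (algebraMap k L).injective
  have h2' : (2 : L) ≠ 0 := by
    rw [← map_ofNat (algebraMap k L) 2]
    exact (map_ne_zero_iff _ hinj).mpr h2
  haveI : NeZero (2 : L) := ⟨h2'⟩
  have ha0 : a' ≠ 0 := (map_ne_zero_iff _ hinj).mpr ha
  have hmem : ∀ x, x ∈ ((C a * X ^ 2 + C b * X + C c).aroots L).toFinset ↔
      a' * (x * x) + b' * x + c' = 0 := fun x ↦ by
    rw [Multiset.mem_toFinset, mem_aroots_quadratic_iff ha]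
  have hdisc : discrim a' b' c' = algebraMap k L (b ^ 2 - 4 * a * c) := by
    simp only [discrim, ha', hb', hc', map_sub, map_mul, map_pow, map_ofNat]
  by_cases hd : b ^ 2 - 4 * a * c = 0
  · simp only [hd, ne_eq, not_true_eq_false, iff_false]
    intro hcard
    have hd' : discrim a' b' c' = 0 := by rw [hdisc, hd, map_zero]
    have hsub : ((C a * X ^ 2 + C b * X + C c).aroots L).toFinset ⊆ {-b' / (2 * a')} := by
      intro x hx
      rw [Finset.mem_singleton]
      exact (quadratic_eq_zero_iff_of_discrim_eq_zero ha0 hd' x).mp ((hmem x).mp hx)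
    have := Finset.card_le_card hsub
    rw [Finset.card_singleton, hcard] at this
    omega
  · simp only [ne_eq, hd, not_false_eq_true, iff_true]
    obtain ⟨s, hs⟩ := IsAlgClosed.exists_eq_mul_self (discrim a' b' c')
    have hs0 : s ≠ 0 := by
      rintro rfl
      rw [mul_zero, hdisc, map_eq_zero_iff _ hinj] at hs
      exact hd hs
    have hne : (-b' + s) / (2 * a') ≠ (-b' - s) / (2 * a') := by
      intro h
      rw [div_left_inj' (mul_ne_zero h2' ha0)] at h
      have h' : (2 : L) * s = 0 := by linear_combination h
      exact (mul_ne_zero h2' hs0) h'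
    have heq : ((C a * X ^ 2 + C b * X + C c).aroots L).toFinset =
        {(-b' + s) / (2 * a'), (-b' - s) / (2 * a')} := by
      ext x
      rw [hmem, Finset.mem_insert, Finset.mem_singleton]
      exact quadratic_eq_zero_iff ha0 hs x
    rw [heq, Finset.card_pair hne]

/-- Special case: the monic quadratic `X² + a X − c` has two distinct roots in `L` iff
`a² + 4c ≠ 0` (this is the form of the quadratics `Y² + a₃,ⱼ Y − a₆,₂ⱼ` of Tate's algorithm,
Silverman ATAEC IV.9.4, steps 7–8). [folklore] -/
theorem card_aroots_toFinset_monicQuadratic_eq_two_iff [DecidableEq L] (a c : k)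
    (h2 : (2 : k) ≠ 0) :
    ((X ^ 2 + C a * X - C c).aroots L).toFinset.card = 2 ↔ a ^ 2 + 4 * c ≠ 0 := by
  have h : (X ^ 2 + C a * X - C c : k[X]) = C 1 * X ^ 2 + C a * X + C (-c) := by
    simp only [map_one, one_mul, map_neg]
    ring
  rw [h, card_aroots_toFinset_quadratic_eq_two_iff one_ne_zero h2]
  have : a ^ 2 - 4 * 1 * -c = a ^ 2 + 4 * c := by ring
  rw [this]

end Quadratic

section Cubic

variable {k : Type*} [Field k] {L : Type*} [Field L] [Algebra k L] [IsAlgClosed L]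

/-- Vieta for the monic cubic `X³ + p X² + q X + r` over an algebraically closed extension `L`:
its roots (with multiplicity) are `{x, y, z}` with `p = −(x+y+z)`, `q = xy+xz+yz`, `r = −xyz`
(Mathlib's `Cubic.eq_sum_three_roots`). [folklore] -/
theorem exists_aroots_cubic_eq (p q r : k) : ∃ x y z : L,
    algebraMap k L p = -(x + y + z) ∧ algebraMap k L q = x * y + x * z + y * z ∧
      algebraMap k L r = -(x * y * z) ∧
      (X ^ 3 + C p * X ^ 2 + C q * X + C r).aroots L = {x, y, z} := by
  set P : Cubic k := ⟨1, p, q, r⟩ with hPdef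
  have hP : P.toPoly = X ^ 3 + C p * X ^ 2 + C q * X + C r := by
    simp only [Cubic.toPoly, hPdef, map_one, one_mul]
  have ha : P.a ≠ 0 := one_ne_zero
  obtain ⟨x, y, z, h3⟩ := (Cubic.splits_iff_roots_eq_three ha).mp
    (IsAlgClosed.splits (P.toPoly.map (algebraMap k L)))
  refine ⟨x, y, z, ?_, ?_, ?_, ?_⟩
  · simpa [hPdef] using Cubic.b_eq_three_roots ha h3
  · simpa [hPdef] using Cubic.c_eq_three_roots ha h3
  · simpa [hPdef] using Cubic.d_eq_three_roots ha h3
  · rw [← hP, aroots_def, ← Cubic.map_toPoly]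
    exact h3

omit [Field L] [IsAlgClosed L] in
/-- `{x, y, z}` as a multiset has the finset `{x, y, z}` as support. [folklore] -/
theorem toFinset_triple [DecidableEq L] (x y z : L) :
    ({x, y, z} : Multiset L).toFinset = ({x, y, z} : Finset L) := by
  ext w
  simp

omit [Field L] [IsAlgClosed L] in
/-- A finset `{x, y, z}` has three elements iff `x, y, z` are pairwise distinct. [folklore] -/
theorem card_triple_eq_three_iff [DecidableEq L] (x y z : L) :
    ({x, y, z} : Finset L).card = 3 ↔ x ≠ y ∧ x ≠ z ∧ y ≠ z := by
  refine ⟨fun h ↦ ⟨?_, ?_, ?_⟩, fun ⟨hxy, hxz, hyz⟩ ↦ ?_⟩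
  · rintro rfl
    have := Finset.card_le_two (a := x) (b := z)
    simp only [Finset.mem_insert, Finset.mem_singleton, true_or, Finset.insert_eq_of_mem] at h
    omega
  · rintro rfl
    have := Finset.card_le_two (a := y) (b := x)
    have h' : ({x, y, x} : Finset L) = {y, x} := by
      ext w; simp only [Finset.mem_insert, Finset.mem_singleton]; tauto
    rw [h'] at h
    omega
  · rintro rfl
    have := Finset.card_le_two (a := x) (b := y)
    have h' : ({x, y, y} : Finset L) = {x, y} := by
      ext w; simp only [Finset.mem_insert, Finset.mem_singleton]; tauto
    rw [h'] at h
    omega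
  · rw [Finset.card_insert_of_notMem, Finset.card_pair hyz]
    simp only [Finset.mem_insert, Finset.mem_singleton, not_or]
    exact ⟨hxy, hxz⟩

omit [IsAlgClosed L] in
/-- The discriminant of `X³ + p X² + q X + r` in terms of its roots. [folklore] -/
theorem algebraMap_cubicDiscr_eq {p q r : k} {x y z : L}
    (hp : algebraMap k L p = -(x + y + z)) (hq : algebraMap k L q = x * y + x * z + y * z)
    (hr : algebraMap k L r = -(x * y * z)) :
    algebraMap k L (p ^ 2 * q ^ 2 - 4 * q ^ 3 - 4 * p ^ 3 * r - 27 * r ^ 2 + 18 * p * q * r) =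
      ((x - y) * (x - z) * (y - z)) ^ 2 := by
  simp only [map_add, map_sub, map_mul, map_pow, map_ofNat, hp, hq, hr]
  ring

/-- The monic cubic `X³ + p X² + q X + r` over `k` has three distinct roots in an algebraically
closed extension `L` iff its discriminant `p²q² − 4q³ − 4p³r − 27r² + 18pqr` is nonzero
(Silverman ATAEC IV.9.4, step 6: "if `P(T)` has distinct roots in `k̄` (i.e., if
`π ∤ Disc(P)`)"). [cite: SilvermanATAEC1994, IV.9.4 step 6] -/
theorem card_aroots_toFinset_cubic_eq_three_iff [DecidableEq L] (p q r : k) :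
    ((X ^ 3 + C p * X ^ 2 + C q * X + C r).aroots L).toFinset.card = 3 ↔
      p ^ 2 * q ^ 2 - 4 * q ^ 3 - 4 * p ^ 3 * r - 27 * r ^ 2 + 18 * p * q * r ≠ 0 := by
  obtain ⟨x, y, z, hp, hq, hr, h3⟩ := exists_aroots_cubic_eq (L := L) p q r
  rw [h3, toFinset_triple, card_triple_eq_three_iff,
    ← map_ne_zero_iff _ (algebraMap k L).injective, algebraMap_cubicDiscr_eq hp hq hr]
  simp only [ne_eq, pow_eq_zero_iff two_ne_zero, mul_eq_zero, sub_eq_zero, not_or]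
  tauto

/-- If the discriminant of the monic cubic `X³ + p X² + q X + r` vanishes, then it has exactly
two distinct roots in `L` (one simple, one double) iff `p² − 3q ≠ 0`; otherwise it has a triple
root (Silverman ATAEC IV.9.4, steps 7 and 8). [folklore] -/
theorem card_aroots_toFinset_cubic_eq_two_iff [DecidableEq L] (p q r : k)
    (hdisc : p ^ 2 * q ^ 2 - 4 * q ^ 3 - 4 * p ^ 3 * r - 27 * r ^ 2 + 18 * p * q * r = 0) :
    ((X ^ 3 + C p * X ^ 2 + C q * X + C r).aroots L).toFinset.card = 2 ↔ p ^ 2 - 3 * q ≠ 0 := by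
  obtain ⟨x, y, z, hp, hq, hr, h3⟩ := exists_aroots_cubic_eq (L := L) p q r
  have key : ((x - y) * (x - z) * (y - z)) ^ 2 = 0 := by
    rw [← algebraMap_cubicDiscr_eq hp hq hr, hdisc, map_zero]
  have key2 : algebraMap k L (p ^ 2 - 3 * q) =
      x ^ 2 + y ^ 2 + z ^ 2 - x * y - x * z - y * z := by
    simp only [map_sub, map_mul, map_pow, map_ofNat, hp, hq]
    ring
  rw [h3, toFinset_triple, ← map_ne_zero_iff _ (algebraMap k L).injective, key2]
  have hcases : x = y ∨ x = z ∨ y = z := by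
    simpa [sub_eq_zero, or_assoc] using key
  rcases hcases with rfl | rfl | rfl
  · have h' : ({x, x, z} : Finset L) = {x, z} := by
      ext w; simp only [Finset.mem_insert, Finset.mem_singleton]; tauto
    have h'' : x ^ 2 + x ^ 2 + z ^ 2 - x * x - x * z - x * z = (x - z) ^ 2 := by ring
    rw [h', h'', Finset.card_pair_eq_two_iff]
    simp [sub_eq_zero]
  · have h' : ({x, y, x} : Finset L) = {x, y} := by
      ext w; simp only [Finset.mem_insert, Finset.mem_singleton]; tauto
    have h'' : x ^ 2 + y ^ 2 + x ^ 2 - x * y - x * x - y * x = (x - y) ^ 2 := by ring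
    rw [h', h'', Finset.card_pair_eq_two_iff]
    simp [sub_eq_zero]
  · have h' : ({x, y, y} : Finset L) = {x, y} := by
      ext w; simp only [Finset.mem_insert, Finset.mem_singleton]; tauto
    have h'' : x ^ 2 + y ^ 2 + y ^ 2 - x * y - x * y - y * y = (x - y) ^ 2 := by ring
    rw [h', h'', Finset.card_pair_eq_two_iff]
    simp [sub_eq_zero]

/-- If the discriminant of `X³ + p X² + q X + r` vanishes but `p² ≠ 3q` (a double, not triple,
root) and `2 ≠ 0` in `k`, then the double root is `k`-rational: there is `a ∈ k` with
`P(a) = 0` and `P'(a) = 0` (namely `a = (9r − pq) / (2 (p² − 3q))`). This is why the translation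
"so that the double root of `P(T)` is `T = 0`" in step 7 of Tate's algorithm exists over any
residue field of characteristic `≠ 2` (Silverman ATAEC IV.9.4, step 7). [folklore] -/
theorem exists_double_root_of_cubicDiscr_eq_zero (h2 : (2 : k) ≠ 0) (p q r : k)
    (hdisc : p ^ 2 * q ^ 2 - 4 * q ^ 3 - 4 * p ^ 3 * r - 27 * r ^ 2 + 18 * p * q * r = 0)
    (hpq : p ^ 2 - 3 * q ≠ 0) :
    ∃ a : k, a ^ 3 + p * a ^ 2 + q * a + r = 0 ∧ 3 * a ^ 2 + 2 * p * a + q = 0 := by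
  let L := AlgebraicClosure k
  obtain ⟨x, y, z, hp, hq, hr, -⟩ := exists_aroots_cubic_eq (L := L) p q r
  set p' := algebraMap k L p with hp'
  set q' := algebraMap k L q with hq'
  set r' := algebraMap k L r with hr'
  have hinj := (algebraMap k L).injective
  have key : ((x - y) * (x - z) * (y - z)) ^ 2 = 0 := by
    rw [← algebraMap_cubicDiscr_eq hp hq hr, hdisc, map_zero]
  have hcases : x = y ∨ x = z ∨ y = z := by
    simpa [sub_eq_zero, or_assoc] using key
  have hroot : ∃ t : L, t ^ 3 + p' * t ^ 2 + q' * t + r' = 0 ∧ 3 * t ^ 2 + 2 * p' * t + q' = 0 := by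
    rcases hcases with rfl | rfl | rfl
    · exact ⟨x, by rw [hp, hq, hr]; ring, by rw [hp, hq]; ring⟩
    · exact ⟨x, by rw [hp, hq, hr]; ring, by rw [hp, hq]; ring⟩
    · exact ⟨y, by rw [hp, hq, hr]; ring, by rw [hp, hq]; ring⟩
  obtain ⟨t, ht1, ht2⟩ := hroot
  have hlin : 2 * (p' ^ 2 - 3 * q') * t = 9 * r' - p' * q' := by
    linear_combination (-9) * ht1 + (p' + 3 * t) * ht2
  have hd : (2 : L) * (p' ^ 2 - 3 * q') ≠ 0 := by
    have : (2 : L) * (p' ^ 2 - 3 * q') = algebraMap k L (2 * (p ^ 2 - 3 * q)) := by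
      simp only [hp', hq', map_mul, map_sub, map_pow, map_ofNat]
    rw [this, map_ne_zero_iff _ hinj]
    exact mul_ne_zero h2 hpq
  set a : k := (9 * r - p * q) / (2 * (p ^ 2 - 3 * q)) with ha
  have hd' : algebraMap k L (2 * (p ^ 2 - 3 * q)) ≠ 0 := by
    simpa only [map_mul, map_sub, map_pow, map_ofNat, ← hp', ← hq'] using hd
  have hat : algebraMap k L a = t := by
    rw [ha, map_div₀, div_eq_iff hd']
    simp only [map_mul, map_sub, map_pow, map_ofNat, ← hp', ← hq', ← hr']
    linear_combination -hlin
  refine ⟨a, hinj ?_, hinj ?_⟩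
  · simp only [map_add, map_mul, map_pow, hat, map_zero, ← hp', ← hq', ← hr']
    exact ht1
  · simp only [map_add, map_mul, map_pow, map_ofNat, hat, map_zero, ← hp', ← hq']
    exact ht2

end Cubic

end TateAlgorithm

end Literature.NumberTheory.DiophantineGeometry
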